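import Literature.AlgebraicTopology.SingularHomology.EilenbergRetractionProofs
import HarnessLib

/-!
# Spanier's homotopies `P(σ)` as data: Eilenberg towers (towards the chain homotopy of Thm. 7.4.8)

Topic `Literature/AlgebraicTopology/SingularHomology`. E. H. Spanier, *Algebraic Topology*
(1981), Ch. 7 §4, Lemma 7 and Theorem 8 (pp. 392–393 of the held copy), absolute case
`A = {x₀}`: to every singular simplex `σ : Δ^q → X` of a `k`-connected space a homotopy
`P(σ) : Δ^q × I → X` is assigned with (a) `P(σ)(z, 0) = σ(z)`, (b) `σ̄ := P(σ)(·, 1)` in the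
Eilenberg subcomplex and `P(σ) = σ ∘ p` when `σ` is in it, (c) `P(σ) ∘ (e^i_q × 1) = P(σ⁽ⁱ⁾)`.
The tree proves the existence of these homotopies level by level
(`EilenbergRetraction.exists_level_zero`, `EilenbergRetraction.exists_level_succ` in
`EilenbergRetractionProofs.lean`) and extracts from them the RETRACTION `σ ↦ σ̄`
(`nonempty_eilenbergRetraction_holds`), which is all the vanishing form of the Hurewicz theorem
needs. The isomorphism form (`hurewicz_iso`; Spanier Thm. 7.5.5 through Cor. 7.4.9) needs the rest
of Thm. 7.4.8 — the chain homotopy `j ∘ τ ≃ 1` of Lemma 7.4.7, "`D'(σ) = Δ(P(σ))(D(ξ_q))`" — and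
hence the homotopies themselves. This file packages them:

* `EilenbergTower X x₀ k` (**structure**): homotopies `P(σ)` of all singular simplices with (a),
  (b), (c); `nonempty_eilenbergTower` — they exist for `X` path connected with `π_q(X, x) = 0` for
  `1 ≤ q ≤ k` and all `x` (recursion on the dimension over the two existence lemmas above; PROVED);
* `EilenbergTower.top` (`σ̄`), `top_face` (`σ̄⁽ⁱ⁾ = σ⁽ⁱ⁾‾`), `isEilenberg_top`, `top_of_isEilenberg`,
  and `EilenbergTower.toRetraction : EilenbergRetraction X x₀ k`.

The chain homotopy built from an Eilenberg tower and the universal prism chains of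
`PrismChains.lean` is in `EilenbergDeformationChains.lean`.

Relation to the rest of the tree. `RelativeEilenbergDeformation.lean`
(`RelativeDeformation.StageData` / `stage`) is the relative analogue for a pair `(X, A)`, built on
the same two gluing lemmas, but truncated at a dimension `m` and with (b) relaxed to "`P(σ) ⊆ A`
when `σ ⊆ A`" — enough for the vanishing clause of the relative Hurewicz theorem, not for the
chain homotopy `1 ≃ j ∘ τ`, which needs `P(σ)` in every dimension and the exact second half of
(b) (`τ ∘ j = 1`); whence this absolute, untruncated packaging.

## References

* E. H. Spanier, *Algebraic Topology*, Springer 1981, Ch. 7 §4, Lemma 7, Thm. 8 (pp. 392–393).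
  [Spanier1981]
* S. Eilenberg, *Singular homology theory*, Ann. of Math. 45 (1944), §31 (the original).
-/

noncomputable section

open Set Function
open scoped Topology Topology.Homotopy

universe u

namespace Literature.AlgebraicTopology.SingularHomology

open SingularSimplex Literature.AlgebraicTopology.Homotopy

variable {X : Type u} [TopologicalSpace X]

/-! ### Eilenberg towers -/

variable (X) in
/-- **An Eilenberg tower of level `k` at `x₀`**: Spanier's data of Lemma 7.4.7 / proof of Thm. 7.4.8
— homotopies `P(σ) : Δ^q × I → X` of all singular simplices with (a) `P(σ)(·, 0) = σ`,
(b) `P(σ)(·, 1)` sends the `k`-skeleton to `x₀` (i.e. `σ̄` is an Eilenberg simplex of level `k`) and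
`P(σ)` is the constant homotopy when `σ` is an Eilenberg simplex, (c) `P(σ) ∘ (δᵢ × 1) = P(σ⁽ⁱ⁾)`.
[cite: Spanier1981, Ch. 7 §4 Lemma 7] -/
structure EilenbergTower (x₀ : X) (k : ℕ) where
  /-- the homotopies `P(σ)` -/
  P : ∀ {q : ℕ}, SingularSimplex X q → C(StdSimplex q × unitInterval, X)
  /-- (a) `P(σ)(t, 0) = σ(t)` -/
  bottom : ∀ {q : ℕ} (σ : SingularSimplex X q) (t : StdSimplex q), P σ (t, 0) = toContinuousMap σ t
  /-- (b), first half: the end map sends the `k`-skeleton to `x₀` -/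
  end_apply : ∀ {q : ℕ} (σ : SingularSimplex X q), ∀ t ∈ stdSkel q k, P σ (t, 1) = x₀
  /-- (b), second half: on Eilenberg simplices the homotopy is constant -/
  apply_of_isEilenberg : ∀ {q : ℕ} (σ : SingularSimplex X q), IsEilenberg x₀ k σ →
    ∀ (t : StdSimplex q) (s : unitInterval), P σ (t, s) = toContinuousMap σ t
  /-- (c) `P(σ)(δᵢ t, s) = P(σ⁽ⁱ⁾)(t, s)` -/
  face : ∀ {q : ℕ} (σ : SingularSimplex X (q + 1)) (i : Fin (q + 2)) (t : StdSimplex q) (s : unitInterval),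
    P σ (stdFace i t, s) = P (σ.face i) (t, s)

/-- **Eilenberg towers exist for `k`-connected spaces** (Spanier 1981, proof of Thm. 7.4.8): `X`
path connected with `π_q(X, x)` trivial for `1 ≤ q ≤ k` and all `x`. The levels are chosen one
dimension at a time by recursion over `EilenbergRetraction.exists_level_zero` /
`EilenbergRetraction.exists_level_succ` (`EilenbergRetractionProofs.lean`), exactly as in
`nonempty_eilenbergRetraction_holds` there, keeping the homotopies. PROVED.
[cite: Spanier1981, Ch. 7 §4 Thm. 8] -/
theorem nonempty_eilenbergTower [PathConnectedSpace X] (x₀ : X) (k : ℕ)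
    (hπ : ∀ q : ℕ, 1 ≤ q → q ≤ k → ∀ x : X, Subsingleton (π_ q X x)) : Nonempty (EilenbergTower X x₀ k) := by
  -- the levels, by recursion on the dimension
  let T := fun q : ℕ =>
    Nat.rec (motive := fun q => {P : SingularSimplex X q → C(StdSimplex q × unitInterval, X) //
        (∀ (σ : SingularSimplex X q) (t : StdSimplex q), P σ (t, 0) = toContinuousMap σ t) ∧
          (∀ σ : SingularSimplex X q, ∀ t ∈ stdSkel q k, P σ (t, 1) = x₀) ∧
          (∀ σ : SingularSimplex X q, IsEilenberg x₀ k σ →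
            ∀ (t : StdSimplex q) (s : unitInterval), P σ (t, s) = toContinuousMap σ t) ∧
          ∀ τ : SingularSimplex X (q + 1), SimplexPrism.Compatible fun i => P (τ.face i)})
      ⟨(EilenbergRetraction.exists_level_zero x₀ k).choose,
        (EilenbergRetraction.exists_level_zero x₀ k).choose_spec⟩
      (fun q s => ⟨(EilenbergRetraction.exists_level_succ hπ s.1 s.2).choose,
        (EilenbergRetraction.exists_level_succ hπ s.1 s.2).choose_spec.1⟩) q
  have hF : ∀ (q : ℕ) (σ : SingularSimplex X (q + 1)) (i : Fin (q + 2)) (t : StdSimplex q)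
      (s : unitInterval), (T (q + 1)).1 σ (stdFace i t, s) = (T q).1 (σ.face i) (t, s) :=
    fun q => (EilenbergRetraction.exists_level_succ hπ (T q).1 (T q).2).choose_spec.2
  exact ⟨{ P := fun {q} σ => (T q).1 σ
           bottom := fun {q} σ t => (T q).2.1 σ t
           end_apply := fun {q} σ t ht => (T q).2.2.1 σ t ht
           apply_of_isEilenberg := fun {q} σ hσ t s => (T q).2.2.2.1 σ hσ t s
           face := fun {q} σ i t s => hF q σ i t s }⟩

namespace EilenbergTower

variable {x₀ : X} {k : ℕ} (T : EilenbergTower X x₀ k)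

/-- **The end simplex `σ̄ = P(σ)(·, 1)`** of the tower (Spanier's `σ̄`). [cite: Spanier1981, Ch. 7 §4 Lemma 7] -/
def top {q : ℕ} (σ : SingularSimplex X q) : SingularSimplex X q :=
  ofMap ⟨fun t => T.P σ (t, 1), (T.P σ).continuous.comp (continuous_id.prodMk continuous_const)⟩

/-- `σ̄` as a map. [folklore] -/
@[simp]
lemma toContinuousMap_top_apply {q : ℕ} (σ : SingularSimplex X q) (t : StdSimplex q) :
    toContinuousMap (T.top σ) t = T.P σ (t, 1) := by
  rw [top, toContinuousMap_ofMap]; rfl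

/-- **The ends commute with the faces**: `σ̄⁽ⁱ⁾ = σ⁽ⁱ⁾‾` (from (c) at time `1`). [folklore] -/
lemma top_face {q : ℕ} (σ : SingularSimplex X (q + 1)) (i : Fin (q + 2)) : (T.top σ).face i = T.top (σ.face i) := by
  apply toContinuousMap_injective; ext t
  rw [toContinuousMap_face_apply, toContinuousMap_top_apply, toContinuousMap_top_apply, T.face]

/-- `σ̄` is an Eilenberg simplex of level `k` ((b), first half). [folklore] -/
lemma isEilenberg_top {q : ℕ} (σ : SingularSimplex X q) : IsEilenberg x₀ k (T.top σ) := fun t ht => by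
  rw [toContinuousMap_top_apply]; exact T.end_apply σ t ht

/-- On Eilenberg simplices `σ̄ = σ` ((b), second half). [folklore] -/
lemma top_of_isEilenberg {q : ℕ} {σ : SingularSimplex X q} (hσ : IsEilenberg x₀ k σ) : T.top σ = σ := by
  apply toContinuousMap_injective; ext t
  rw [toContinuousMap_top_apply, T.apply_of_isEilenberg σ hσ]

/-- The start simplex `P(σ)(·, 0)` is `σ` ((a)). [folklore] -/
lemma ofMap_bottom {q : ℕ} (σ : SingularSimplex X q) :
    ofMap ⟨fun t => T.P σ (t, 0), (T.P σ).continuous.comp (continuous_id.prodMk continuous_const)⟩ = σ := by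
  apply toContinuousMap_injective; ext t
  rw [toContinuousMap_ofMap]
  exact T.bottom σ t

/-- **The end maps of an Eilenberg tower form an Eilenberg retraction** (`EilenbergRetraction.lean`).
[cite: Spanier1981, Ch. 7 §4 Lemma 7] -/
def toRetraction : EilenbergRetraction X x₀ k where
  ρ := fun σ => T.top σ
  face_ρ := fun σ i => T.top_face σ i
  isEilenberg_ρ := fun σ => T.isEilenberg_top σ
  ρ_eq_self := fun _ hσ => T.top_of_isEilenberg hσ

/-- The retraction of the tower on a simplex is its end simplex. [folklore] -/
@[simp]
lemma toRetraction_ρ {q : ℕ} (σ : SingularSimplex X q) : T.toRetraction.ρ σ = T.top σ := rfl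

end EilenbergTower

end Literature.AlgebraicTopology.SingularHomology

end
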